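import Mathlib
import Summits.ResolutionOfSingularities.ResolutionOfSingularities.Theorems.PurelyInseparableDim4ScopeDictionaryPrimePower
import HarnessLib

/-!
# AbsoluteRiderLucas — decomp-res node «AbsoluteRider» (lens-4 g20, critic row 132)

Content VERBATIM from the decomp-res lens-4 g20 file `HOME/decomp-res-lens-4/g20/AbsoluteRider.lean` (sha256
d859489ca280dd37, 4114 l; HOME = run/shared/lean/pub/
decomp-res), of which l. 178–3705 are the g19 RiderCut body ALREADY in the tree (`Theorems/HugValuationCut*`,
`MarkingBudget*`, `WeightDescent*`, `FactorContact*`,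
`CouplingCut*`, `RiderCutClasses` / `RiderCutKernels` / `MaxContactCutRiderCut`) and are NOT landed a second time;
the NEW content §38–§42 (l. 3707–4113) lands as
three files: `AbsoluteRider` (§38–§40, in the Theses cone), `AbsoluteRiderHasse` (§41, cone-free kernel
instance), `AbsoluteRiderLucas` (§42, arithmetic).
Critic: CRITIC-LEDGER row 132 (CLEARED 2026-08-30T18:49:46Z, DECIDED-MOD-PORT +1: the impure principal column
(L,P,¬pure) of 32260 over EVERY ground field is
EMPTY modulo the costume port `AbsRiderPort` (+ `CouplingPort` + lower weights) · MAP +1: §41/§42 kernels).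
Landed by decomp-res writer g7.

Tree file 3/3 of the node, OUTSIDE the Theses cone, pure arithmetic: §42 THE LUCAS BITE of law (R3) —
`choose_mul_modEq`, `choose_pow_mul_modEq`,
`choose_pow_mul_self_modEq` (`C(p^a·u, p^a) ≡ u (mod p)`), `dvd_choose_pow_mul_iff`, `pow_padicValNat_le`; from
Mathlib's one-step Lucas.  The lens's
`not_dvd_choose_pow_padicValNat` (`p ∤ C(e, p^{v_p(e)})`, `e ≠ 0`) is ALREADY the tree's
`PIDim4.ScopeDictionaryPrimePower.not_dvd_choose_pow_padicValNat` (same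
statement; module `PurelyInseparableDim4ScopeDictionaryPrimePower`, imported here) and is not restated.  PROVED, 0
sorry.  Supports 32260.

[WRITER NOTE (decomp-res writer g7): as for every lens-4 node since g6, the content lives in the ONE namespace
`…Theorems.HugValuationCut` (the lens wrote
`…Theorems.AbsoluteRider`; only the namespace line differs) so that `RiderPort`, `CouplingPort`, `HugChain.…`
resolve against the landed units verbatim; global
`set_option` lines dropped; critic hygiene h2 applied in docstrings only («Cor 4.5» ↦ «Rem 4.5», arXiv
numbering of Abad 2019).  No new route aside: the node
decides a column, it does not re-locate the residual (host 32260 / root 30253 / up-links BY NAME in `AbsoluteRider`).]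

(Sources: Abad2019 (doi:10.1016/j.jalgebra.2018.12.021 = arXiv:1801.08458) Thm 4.11, Prop 4.4, Rem 4.5, Lemma 6.2,
Prop 6.3; CossartPiltant2019 Prop 2.50(3); CossartJannsenSaito2020 Key Thm 6.40; Giraud1975; EGA IV₄ 16.11.2; Stacks 00TV.)
-/

noncomputable section

namespace Summit.ResolutionOfSingularities.ResolutionOfSingularities.Theorems.HugValuationCut

/-! ## §42 (g20 · NEW · KERNEL, hypothesis-free) THE LUCAS BITE of law (R3) — the arithmetic that makes the
Hasse–Lucas descent land
EXACTLY on multiplicity `p^{v_p(e_i)}`: `C(p^a·u, p^a) ≡ u (mod p)` (iterated Frobenius step of Lucas, from Mathlib's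
`Choose.choose_modEq_choose_mod_mul_choose_div_nat`), hence `p ∤ C(e, p^{v_p(e)})` for every `e ≠ 0`.  In STEP 4
of (R3ᵃᵇˢ) the leading
coefficient of `D^[𝔅;β] r`, `β = e − p^a·𝟙_i`, is `C(e_i, p^a) ≢ 0 (mod p)` by `not_dvd_choose_pow_padicValNat`. -/
/-- one Frobenius step of Lucas: `C(p·n, p·k) ≡ C(n, k) (mod p)`. [folklore] -/
theorem choose_mul_modEq (p : ℕ) [Fact p.Prime] (n k : ℕ) : (p * n).choose (p * k) ≡ n.choose k [MOD p] := by
  have h := @Choose.choose_modEq_choose_mod_mul_choose_div_nat (p * n) (p * k) p _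
  have hp : 0 < p := (Fact.out : p.Prime).pos
  simpa [Nat.mul_mod_right, Nat.mul_div_cancel_left _ hp] using h

/-- iterated: `C(p^a·n, p^a·k) ≡ C(n, k) (mod p)`. [folklore] -/
theorem choose_pow_mul_modEq (p : ℕ) [Fact p.Prime] (a n k : ℕ) :
    (p ^ a * n).choose (p ^ a * k) ≡ n.choose k [MOD p] := by
  induction a with
  | zero => simp [Nat.ModEq.refl]
  | succ a ih =>
    have h1 : p ^ (a + 1) * n = p * (p ^ a * n) := by ring
    have h2 : p ^ (a + 1) * k = p * (p ^ a * k) := by ring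
    rw [h1, h2]
    exact (choose_mul_modEq p _ _).trans ih

/-- **THE LUCAS BITE**: `C(p^a·u, p^a) ≡ u (mod p)`. [folklore] -/
theorem choose_pow_mul_self_modEq (p : ℕ) [Fact p.Prime] (a u : ℕ) : (p ^ a * u).choose (p ^ a) ≡ u [MOD p] := by
  simpa using choose_pow_mul_modEq p a u 1

/-- `p ∣ C(p^a·u, p^a) ↔ p ∣ u`. [folklore] -/
theorem dvd_choose_pow_mul_iff (p : ℕ) [Fact p.Prime] (a u : ℕ) : p ∣ (p ^ a * u).choose (p ^ a) ↔ p ∣ u := by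
  have h : (p ^ a * u).choose (p ^ a) % p = u % p := choose_pow_mul_self_modEq p a u
  constructor
  · intro hd
    exact Nat.dvd_of_mod_eq_zero (by rw [← h]; exact Nat.mod_eq_zero_of_dvd hd)
  · intro hd
    exact Nat.dvd_of_mod_eq_zero (by rw [h]; exact Nat.mod_eq_zero_of_dvd hd)

/-- the descent exponent is at most the exponent: `p^{v_p(e)} ≤ e` for `e ≠ 0`. [folklore] -/
theorem pow_padicValNat_le (p : ℕ) {e : ℕ} (he : e ≠ 0) : p ^ padicValNat p e ≤ e :=
  Nat.le_of_dvd (Nat.pos_of_ne_zero he) pow_padicValNat_dvd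

end Summit.ResolutionOfSingularities.ResolutionOfSingularities.Theorems.HugValuationCut
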